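import Summits.Ventures.DiscreteObjects.Hadamard.AffineSymmetryGSQuad668
import Summits.Ventures.DiscreteObjects.Hadamard.SkewTypeRows668
import Summits.Ventures.DiscreteObjects.Hadamard.ReversalSixTurynType668
import Summits.Ventures.DiscreteObjects.Hadamard.AffineSymmetryQuaternary668Conj

/-!
# Hadamard 668 census — the gen-26 symmetry census of the sequence families in ONE statement (kernel summary)

Framing: lottery ticket; floor = certified bounds/negative ranges.

Cell pub-namedobj (venture DiscreteObjects), target (H), hadamard gen 26.  One conjunction restating, with their hypotheses, the
structured-sub-family exclusions landed this generation (citation point for STATEMENT.md / the paper section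
PAPER-SECTION-H-symmetry-census-g26); nothing new is proved here:
(1) four circulants over `ZMod 167` (GS first equation): a signed/permuted affine symmetry has multiplier `h` with `h² = 1`
    (`gsQuad167_affineSymmetry_sq_eq_one`);
(2) a common non-zero translation symmetry is impossible (`gsQuad167_no_commonTranslation`);
(3) three skew-type rows are impossible — no best matrices of order 167 (`gsQuad167_no_three_skewType`);
(4) the 6-Turyn-type line `2m + n = 167`, `3 ≤ m ≤ 82` (hence `TT(56)`): the weight-one pair is never reversal-closed
    (`no_reversalClosedPair_sixTurynType_167`);
(5) quaternary two-circulant `CH(334)` (row F7): a swap/phase/conjugation/shift-twisted affine symmetry has `h² = 1`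
    (`quatPair167_conjAffineSymmetry_sq_eq_one`).
Base sequences `BS(m, m, n, n)`, `m + n = 167` (`ReversalBaseSequences668`, via the gen-25 T-matrix census) are summarised separately
once that chain is in the tree.  No Hadamard order excluded; H(668) untouched; HITS 0/4.  Ours; no `sorry`.
-/

namespace Summit.Ventures.DiscreteObjects.Hadamard

open Literature.Combinatorics.Designs.TSequences
open Literature.Combinatorics.Designs.SixTurynType

/-- **The gen-26 symmetry census at order 668 (kernel summary).**  See the module docstring for the five conjuncts.
lottery ticket; floor = certified bounds/negative ranges. -/
theorem hadamard668_symmetryCensus_gen26 :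
    -- (1) four circulants: affine symmetries have multiplier ±1
    (∀ (a : Fin 4 → ZMod 167 → ℤ), GSQuad (a 0) (a 1) (a 2) (a 3) →
      ∀ (h : ZMod 167) (c : Fin 4 → ZMod 167) (π : Equiv.Perm (Fin 4)) (ε : Fin 4 → ℤ), (∀ k, ε k = 1 ∨ ε k = -1) →
        (∀ k x, a (π k) (h * x + c k) = ε k * a k x) → h ^ 2 = 1) ∧
    -- (2) no common non-zero translation symmetry
    (∀ (c : ZMod 167), c ≠ 0 → ∀ (π : Equiv.Perm (Fin 4)) (ε : Fin 4 → ℤ), (∀ k, ε k = 1 ∨ ε k = -1) →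
      ¬ ∃ a : Fin 4 → ZMod 167 → ℤ, GSQuad (a 0) (a 1) (a 2) (a 3) ∧ ∀ k x, a (π k) (x + c) = ε k * a k x) ∧
    -- (3) no three skew-type rows (no best matrices of order 167)
    (∀ (a b c d : ZMod 167 → ℤ), GSQuad a b c d → (∀ x, x ≠ 0 → a (-x) = -a x) → (∀ x, x ≠ 0 → b (-x) = -b x) →
      ¬ ∀ x, x ≠ 0 → c (-x) = -c x) ∧
    -- (4) the 6-Turyn-type line: the weight-one pair is never reversal-closed
    (∀ (m n : ℕ) (x y z w : ℕ → ℤ), 2 * m + n = 167 → 3 ≤ m → m ≤ 82 → IsSixTurynType m n x y z w →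
      ∀ (σ : Equiv.Perm (Fin 2)) (e : Fin 2 → ℤ), (∀ j, e j = 1 ∨ e j = -1) →
        ¬ ∀ j, ∀ i, i < m → (![x, y] (σ j)) (m - 1 - i) = e j * (![x, y] j) i) ∧
    -- (5) quaternary two-circulant CH(334): twisted affine symmetries have multiplier ±1
    (∀ (x : Fin 2 → ZMod 167 → GaussianInt), (∀ k, IsQuat (x k)) →
      (∀ s : ZMod 167, s ≠ 0 → CPAF (x 0) s + CPAF (x 1) s = 0) →
      ∀ (h : ZMod 167) (c : Fin 2 → ZMod 167) (π : Equiv.Perm (Fin 2)) (ε : Fin 2 → GaussianInt) (σ : Fin 2 → Bool),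
        (∀ k, ε k ∈ quatUnits) → (∀ k t, x (π k) (h * t + c k) = ε k * (if σ k then star (x k t) else x k t)) → h ^ 2 = 1) :=
  ⟨fun _ hq _ _ _ _ hε hrel => gsQuad167_affineSymmetry_sq_eq_one hq hε hrel,
   fun _ hc π ε hε => gsQuad167_no_commonTranslation hc π ε hε,
   fun _ _ _ _ hq ha hb hc => gsQuad167_no_three_skewType hq ha hb hc,
   fun _ _ _ _ _ _ hmn hm hm' h _ _ he hxy => no_reversalClosedPair_sixTurynType_167 hmn hm hm' h he hxy,
   fun x hq hC _ _ _ _ _ hε hrel => quatPair167_conjAffineSymmetry_sq_eq_one x hq hC hε hrel⟩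

end Summit.Ventures.DiscreteObjects.Hadamard
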